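import Summits.CriticalPhenomena.PercolationContinuityZ3.Theorems.PercNearOneGluingNoHeavyLowerTailSahiHubCornerBoxSquare
import Mathlib.Data.Finset.Option
import Mathlib.Algebra.BigOperators.Group.Finset.Powerset
import Mathlib.Tactic.Linarith
import Mathlib.Tactic.Positivity
import Mathlib.Tactic.FinCases
import HarnessLib

/-!
# `NoHeavyLowerTail` (crux stmt-CriticalPhenomena-4575), P2 — THE STAR CRITERION FOR THE BOX FORM OF ANY DIMENSION: the fibre
# kernel of every STAR ratio is nonnegative by the antipodal lemma on the `(1+|D|)`-cube of slots

Seat `prim-masterthm-p2`, gen 32 (memo `FROM-prim-masterthm-p2-g32-BOX-FLOWS-AND-STAR.md` §1–§2, SAHI-ROUTE.md §4.59;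
`--supports stmt-CriticalPhenomena-4575`).  No `sorry`, no named facts, standard axioms.

By `…SahiHubCornerBoxSquare`, for every ratio `ρ` on the slots `(z, a ∪ u)` (`z ∈ Fin 2`, `u ⊆ D`) of the box `[a, a ∪ D] ⊆ Finset κ`,
`boxSum a D = 2·(Σ_b wB·boxFib ρ + boxCP ρ + boxEnv ρ)`, and `boxSum a D ≥ 0` as soon as `ρ ∈ [0,1]`, `boxFib ρ a D b ≥ 0` at every
fibre `b` and `boxEnv ρ a D ≥ 0` (`boxSum_nonneg_of_fibre`).  THIS FILE discharges the FIBRE hypothesis uniformly in the dimension: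
* The slots form the Boolean box `2^{D'}`, `D' = {⋆} ∪ D` realised inside `Finset (Option κ)` (`⋆ = none`), with complement = the
  antipode `(z, a∪u) ↦ (1−z, a∪(D∖u))`; at a fixed fibre `b` the slot functions `s ↦ F_s, H_{z(s)}(b), Ys_s(b), ρ_s, g_s(b)` are
  monotone on this box, `F·H ≤ Y` is the FKG slice bound on `α`, and `boxFib ρ a D b` IS the antipodal sum of the tree's antipodal
  lemma `SahiBox.antipodal_box` (gen 9, the `G3`/STAR mechanism of class T) on that box (`boxFib_eq_antipodal`).
* **`boxFib_nonneg_of_star`**: hence for every `ρ ∈ [0,1]` satisfying the STAR inequality `F_{s'} ≤ (1 − ρ_s + ρ_{s'})·F_s`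
  for comparable slots `s' ≤ s` of the box (section means `F_s = Fp z (a ∪ u)`), the fibre kernel is nonnegative at every fibre.
* **`boxSum_nonneg_of_star` (THE STAR CRITERION, any dimension):** a STAR ratio with `boxEnv ρ a D ≥ 0` certifies `boxSum a D ≥ 0`.
* **`sahiE_three_nonneg_T1_cube_of_star`:** T₁ — Kahn's `C₃` for `f(z,c,a), g(z,c,b), h(z,a,b)` with `c` in a cube of ANY dimension
  with any log-modular probability weight — holds as soon as every box of dimension `≥ 2` admits a STAR ratio with nonnegative
  environment remainder (an explicit finite-dimensional inequality in the section means, slice masses and `H̄₀, H̄₁`).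
STAR ratios include `ρ_s = 1 − F_{π(s)}/F_s` for any monotone deflationary `π` and gen-9's `1 − λ/F_s` (memo §1); the memo
records that a STAR certificate exists for ≈ 97–99 % of sampled data in this orientation (and, on all sampled ACTUAL data, in one of
the two orientations `f ↔ g`), and where it does not (gen 29's `m = 1` rule is not STAR: the exact fibre polytope needs POOLED margins).
HONEST LABEL: criterion; the box inequalities, T₁ with ≥ 2 co-shared coins and Kahn's `C₃` remain OPEN. [this work]
-/

noncomputable section

open scoped Classical

namespace Summit.CriticalPhenomena.PercolationContinuityZ3.Theorems

namespace SahiHubCornerChain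

open Finset Literature.Combinatorics.Sahi2008 SahiHubCorner SahiHubTwoLevel
open SahiTriangleSupermodular (fkg_sum)

section Slots

variable {κ : Type}

/-- Hub level of a slot code `s ⊆ {⋆} ∪ D` (`⋆ = none`): `1` iff `⋆ ∈ s`. [this work] -/
def zOf (s : Finset (Option κ)) : Fin 2 := if none ∈ s then 1 else 0

/-- Block point of a slot code relative to the box `[a, a ∪ D]`: `a ∪ (eraseNone s ∩ D)`. [this work] -/
def xOf (a D : Finset κ) (s : Finset (Option κ)) : Finset κ := a ∪ (Finset.eraseNone s ∩ D)

/-- The slot box `D' = {⋆} ∪ D` inside `Finset (Option κ)`. [this work] -/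
def slotBox (D : Finset κ) : Finset (Option κ) := insert none (D.map Function.Embedding.some)

/-- The hub level of a slot code is monotone in the code. [this work] -/
theorem zOf_mono {s t : Finset (Option κ)} (hst : s ⊆ t) : zOf s ≤ zOf t := by
  unfold zOf
  by_cases hs : none ∈ s
  · rw [if_pos hs, if_pos (hst hs)]
  · rw [if_neg hs]; exact Fin.zero_le _

/-- The block point of a slot code is monotone in the code. [this work] -/
theorem xOf_mono (a D : Finset κ) {s t : Finset (Option κ)} (hst : s ⊆ t) : xOf a D s ⊆ xOf a D t :=
  union_subset_union (le_refl a) (inter_subset_inter (Finset.eraseNone.monotone hst) (le_refl D))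

/-- `⋆ = none` is not a code of a block subset. [folklore] -/
theorem none_notMem_map (u : Finset κ) : (none : Option κ) ∉ u.map Function.Embedding.some := by simp

/-- Adding `⋆` does not change the block part of a code. [folklore] -/
theorem eraseNone_insert_none (t : Finset (Option κ)) : Finset.eraseNone (insert none t) = Finset.eraseNone t := by
  ext k; simp

/-- `eraseNone (D' \ t) = D \ eraseNone t`. [this work] -/
theorem eraseNone_slotBox_sdiff (D : Finset κ) (t : Finset (Option κ)) :
    Finset.eraseNone (slotBox D \ t) = D \ Finset.eraseNone t := by
  ext k
  simp [slotBox, Finset.mem_sdiff]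

/-- A pure block code sits at hub level `0`. [this work] -/
theorem zOf_map (u : Finset κ) : zOf (u.map Function.Embedding.some) = 0 := by
  unfold zOf; rw [if_neg (none_notMem_map u)]

/-- A code containing `⋆` sits at hub level `1`. [this work] -/
theorem zOf_insert (t : Finset (Option κ)) : zOf (insert none t) = 1 := by
  unfold zOf; rw [if_pos (mem_insert_self _ _)]

/-- The antipode of a level-`0` slot is at level `1`. [this work] -/
theorem zOf_slotBox_sdiff_map (D u : Finset κ) : zOf (slotBox D \ u.map Function.Embedding.some) = 1 := by
  unfold zOf
  rw [if_pos]
  exact Finset.mem_sdiff.2 ⟨mem_insert_self _ _, none_notMem_map u⟩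

/-- The antipode of a level-`1` slot is at level `0`. [this work] -/
theorem zOf_slotBox_sdiff_insert (D : Finset κ) (t : Finset (Option κ)) : zOf (slotBox D \ insert none t) = 0 := by
  unfold zOf
  rw [if_neg]
  exact fun hm => (Finset.mem_sdiff.1 hm).2 (mem_insert_self _ _)

/-- Block point of the level-`0` code of `u ⊆ D`: `a ∪ u`. [this work] -/
theorem xOf_map (a D u : Finset κ) (hu : u ⊆ D) : xOf a D (u.map Function.Embedding.some) = a ∪ u := by
  unfold xOf; rw [Finset.eraseNone_map_some, inter_eq_left.2 hu]

/-- Block point of the level-`1` code of `u ⊆ D`: `a ∪ u`. [this work] -/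
theorem xOf_insert_map (a D u : Finset κ) (hu : u ⊆ D) : xOf a D (insert none (u.map Function.Embedding.some)) = a ∪ u := by
  unfold xOf; rw [eraseNone_insert_none, Finset.eraseNone_map_some, inter_eq_left.2 hu]

/-- Block point of the antipode of the level-`0` code of `u`: `a ∪ (D ∖ u)`. [this work] -/
theorem xOf_slotBox_sdiff_map (a D u : Finset κ) : xOf a D (slotBox D \ u.map Function.Embedding.some) = a ∪ (D \ u) := by
  unfold xOf; rw [eraseNone_slotBox_sdiff, Finset.eraseNone_map_some, inter_eq_left.2 sdiff_subset]

/-- Block point of the antipode of the level-`1` code of `u`: `a ∪ (D ∖ u)`. [this work] -/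
theorem xOf_slotBox_sdiff_insert (a D u : Finset κ) :
    xOf a D (slotBox D \ insert none (u.map Function.Embedding.some)) = a ∪ (D \ u) := by
  unfold xOf; rw [eraseNone_slotBox_sdiff, eraseNone_insert_none, Finset.eraseNone_map_some, inter_eq_left.2 sdiff_subset]

/-- Sums over the slot box split into the two hub levels over the block box:
`Σ_{s ⊆ D'} φ(s) = Σ_{u ⊆ D} [φ(u) + φ({⋆} ∪ u)]` (slot codes of `u`). [this work] -/
theorem sum_slotBox (D : Finset κ) (φ : Finset (Option κ) → ℝ) :
    ∑ s ∈ (slotBox D).powerset, φ s =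
      ∑ u ∈ D.powerset, (φ (u.map Function.Embedding.some) + φ (insert none (u.map Function.Embedding.some))) := by
  unfold slotBox
  rw [Finset.sum_powerset_insert (none_notMem_map D), sum_add_distrib]
  have key : ∀ ψ : Finset (Option κ) → ℝ,
      ∑ t ∈ (D.map Function.Embedding.some).powerset, ψ t = ∑ u ∈ D.powerset, ψ (u.map Function.Embedding.some) := by
    intro ψ
    symm
    refine sum_nbij' (fun u => u.map Function.Embedding.some) (fun t => Finset.eraseNone t) ?_ ?_ ?_ ?_ ?_
    · intro u hu; exact mem_powerset.2 (map_subset_map.2 (mem_powerset.1 hu))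
    · intro t ht
      refine mem_powerset.2 fun k hk => ?_
      have hk' : some k ∈ D.map Function.Embedding.some := mem_powerset.1 ht (Finset.mem_eraseNone.1 hk)
      simpa using hk'
    · intro u _; exact Finset.eraseNone_map_some u
    · intro t ht
      have hnone : none ∉ t := fun hn => none_notMem_map D (mem_powerset.1 ht hn)
      rw [Finset.map_some_eraseNone, erase_eq_of_notMem hnone]
    · intro u _; rfl
  rw [key, key]

end Slots

section Star

variable {κ α β : Type} [Fintype α] [Fintype β]
  {wA : α → ℝ} {wB : β → ℝ} {f : Fin 2 → Finset κ → α → ℝ} {g : Fin 2 → Finset κ → β → ℝ} {h : Fin 2 → α → β → ℝ}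

omit [Fintype α] [Fintype β] in
/-- Joint monotonicity of a two-level section family along the slot order. [this work] -/
theorem slot_mono {φ : Fin 2 → Finset κ → ℝ} (hc : ∀ z, Monotone (φ z)) (hz : ∀ c, φ 0 c ≤ φ 1 c)
    {z z' : Fin 2} {c c' : Finset κ} (hzz : z ≤ z') (hcc : c ⊆ c') : φ z c ≤ φ z' c' := by
  have h1 : φ z c ≤ φ z c' := hc z hcc
  fin_cases z <;> fin_cases z'
  · exact h1
  · exact h1.trans (hz c')
  · exact absurd hzz (by decide)
  · exact h1

omit [Fintype β] in
/-- **THE FIBRE KERNEL IS AN ANTIPODAL SUM.**  At the fibre `b`, `boxFib ρ a D b` is the antipodal sum of `SahiBox.antipodal_box` on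
the slot box `D' = {⋆} ∪ D` for the slot functions `F, H, Y, ρ, g`. [this work] -/
theorem boxFib_eq_antipodal (ρ : Fin 2 → Finset κ → ℝ) (a D : Finset κ) (b : β) :
    boxFib wA f g h ρ a D b =
      ∑ s ∈ (slotBox D).powerset,
        g (zOf s) (xOf a D s) b *
          ((2 - ρ (zOf s) (xOf a D s)) * Ys wA f h (zOf s) (xOf a D s) b
            - Fp wA f (zOf (slotBox D \ s)) (xOf a D (slotBox D \ s)) * Hsl wA h (zOf s) b
            - (1 - ρ (zOf (slotBox D \ s)) (xOf a D (slotBox D \ s))) * Ys wA f h (zOf (slotBox D \ s)) (xOf a D (slotBox D \ s)) b) := by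
  rw [sum_slotBox]
  unfold boxFib
  refine sum_congr rfl fun u hu => ?_
  have huD : u ⊆ D := mem_powerset.1 hu
  rw [zOf_map, zOf_insert, xOf_map a D u huD, xOf_insert_map a D u huD, zOf_slotBox_sdiff_map, zOf_slotBox_sdiff_insert,
    xOf_slotBox_sdiff_map, xOf_slotBox_sdiff_insert]
  unfold kerPair
  ring

omit [Fintype β] in
/-- **THE FIBRE KERNEL OF A STAR RATIO IS NONNEGATIVE** (every dimension).  `α` FKG; sections nonnegative and monotone in every
argument; `ρ ∈ [0,1]`; STAR on the comparable slots of the box: `F_{z'}(a∪u') ≤ (1 − ρ_z(a∪u) + ρ_{z'}(a∪u'))·F_z(a∪u)` for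
`z' ≤ z`, `u' ⊆ u ⊆ D`. [this work] -/
theorem boxFib_nonneg_of_star [DistribLattice α] [Preorder β] (hA : IsFKGMeasure wA)
    (hf0 : ∀ z c a, 0 ≤ f z c a) (hfa : ∀ z c, Monotone (f z c)) (hfc : ∀ z a, Monotone (fun c => f z c a))
    (hfz : ∀ c a, f 0 c a ≤ f 1 c a)
    (hg0 : ∀ z c b, 0 ≤ g z c b) (hgc : ∀ z b, Monotone (fun c => g z c b)) (hgz : ∀ c b, g 0 c b ≤ g 1 c b)
    (hh0 : ∀ z a b, 0 ≤ h z a b) (hha : ∀ z b, Monotone (fun a => h z a b)) (hhz : ∀ a b, h 0 a b ≤ h 1 a b)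
    {ρ : Fin 2 → Finset κ → ℝ} (hρ0 : ∀ z c, 0 ≤ ρ z c) (hρ1 : ∀ z c, ρ z c ≤ 1) (a D : Finset κ)
    (hstar : ∀ (z z' : Fin 2) (u u' : Finset κ), u ⊆ D → u' ⊆ u → z' ≤ z →
      Fp wA f z' (a ∪ u') ≤ (1 - ρ z (a ∪ u) + ρ z' (a ∪ u')) * Fp wA f z (a ∪ u))
    (b : β) : 0 ≤ boxFib wA f g h ρ a D b := by
  have hA0 := hA.nonneg
  rw [boxFib_eq_antipodal]
  -- monotonicity of the slot functions along the slot box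
  have hFmono : Monotone fun s : Finset (Option κ) => Fp wA f (zOf s) (xOf a D s) := fun s t hst =>
    sum_le_sum fun a' _ => mul_le_mul_of_nonneg_left
      (slot_mono (φ := fun z c => f z c a') (fun z => hfc z a') (fun c => hfz c a') (zOf_mono hst) (xOf_mono a D hst)) (hA0 a')
  have hF0 : ∀ s : Finset (Option κ), 0 ≤ Fp wA f (zOf s) (xOf a D s) := fun s =>
    sum_nonneg fun a' _ => mul_nonneg (hA0 a') (hf0 _ _ a')
  have hHmono : Monotone fun s : Finset (Option κ) => Hsl wA h (zOf s) b := by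
    intro s t hst
    refine sum_le_sum fun a' _ => mul_le_mul_of_nonneg_left ?_ (hA0 a')
    have hz := zOf_mono hst
    revert hz
    generalize zOf s = z; generalize zOf t = z'
    intro hz
    fin_cases z <;> fin_cases z'
    · exact le_refl _
    · exact hhz a' b
    · exact absurd hz (by decide)
    · exact le_refl _
  have hH0 : ∀ s : Finset (Option κ), 0 ≤ Hsl wA h (zOf s) b := fun s => sum_nonneg fun a' _ => mul_nonneg (hA0 a') (hh0 _ a' b)
  have hYmono : Monotone fun s : Finset (Option κ) => Ys wA f h (zOf s) (xOf a D s) b := by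
    intro s t hst
    refine sum_le_sum fun a' _ => mul_le_mul_of_nonneg_left ?_ (hA0 a')
    have hz := zOf_mono hst
    have hx := xOf_mono a D hst
    have hf' := slot_mono (φ := fun z c => f z c a') (fun z => hfc z a') (fun c => hfz c a') hz hx
    have hh' : h (zOf s) a' b ≤ h (zOf t) a' b := by
      revert hz; generalize zOf s = z; generalize zOf t = z'; intro hz
      fin_cases z <;> fin_cases z'
      · exact le_refl _
      · exact hhz a' b
      · exact absurd hz (by decide)
      · exact le_refl _
    exact mul_le_mul hf' hh' (hh0 _ a' b) (hf0 _ _ a')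
  have hFH : ∀ s : Finset (Option κ), Fp wA f (zOf s) (xOf a D s) * Hsl wA h (zOf s) b ≤ Ys wA f h (zOf s) (xOf a D s) b := by
    intro s
    unfold Fp Hsl Ys
    exact fkg_sum hA (hf0 _ _) (hh0 _ · b) (hfa _ _) (hha _ b)
  have hg0' : ∀ s : Finset (Option κ), 0 ≤ g (zOf s) (xOf a D s) b := fun s => hg0 _ _ b
  have hgmono : Monotone fun s : Finset (Option κ) => g (zOf s) (xOf a D s) b := fun s t hst =>
    slot_mono (φ := fun z c => g z c b) (fun z => hgc z b) (fun c => hgz c b) (zOf_mono hst) (xOf_mono a D hst)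
  have hstar' : ∀ c c' : Finset (Option κ), c' ≤ c →
      Fp wA f (zOf c') (xOf a D c') ≤ (1 - ρ (zOf c) (xOf a D c) + ρ (zOf c') (xOf a D c')) * Fp wA f (zOf c) (xOf a D c) := by
    intro c c' hcc
    unfold xOf
    exact hstar (zOf c) (zOf c') (Finset.eraseNone c ∩ D) (Finset.eraseNone c' ∩ D) inter_subset_right
      (inter_subset_inter (Finset.eraseNone.monotone hcc) (le_refl D)) (zOf_mono hcc)
  exact SahiBox.antipodal_box (slotBox D) (F := fun s => Fp wA f (zOf s) (xOf a D s)) (H := fun s => Hsl wA h (zOf s) b)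
    (Y := fun s => Ys wA f h (zOf s) (xOf a D s) b) (r := fun s => ρ (zOf s) (xOf a D s)) (g := fun s => g (zOf s) (xOf a D s) b)
    hFmono hF0 hHmono hH0 hYmono hFH (fun s => hρ0 _ _) (fun s => hρ1 _ _) hstar' hg0' hgmono

/-- **THE STAR CRITERION (box of any dimension).**  `α, β` FKG; sections nonnegative and monotone in every argument.  If some
`ρ ∈ [0,1]` satisfies STAR on the slots of the box `[a, a ∪ D]` and has environment remainder `boxEnv ρ a D ≥ 0`, then
`boxSum a D ≥ 0`. [this work] -/
theorem boxSum_nonneg_of_star [DistribLattice α] [DistribLattice β] (hA : IsFKGMeasure wA) (hB : IsFKGMeasure wB)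
    (hf0 : ∀ z c a, 0 ≤ f z c a) (hfa : ∀ z c, Monotone (f z c)) (hfc : ∀ z a, Monotone (fun c => f z c a))
    (hfz : ∀ c a, f 0 c a ≤ f 1 c a)
    (hg0 : ∀ z c b, 0 ≤ g z c b) (hgb : ∀ z c, Monotone (g z c)) (hgc : ∀ z b, Monotone (fun c => g z c b))
    (hgz : ∀ c b, g 0 c b ≤ g 1 c b)
    (hh0 : ∀ z a b, 0 ≤ h z a b) (hha : ∀ z b, Monotone (fun a => h z a b)) (hhb : ∀ z a, Monotone (h z a))
    (hhz : ∀ a b, h 0 a b ≤ h 1 a b)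
    {ρ : Fin 2 → Finset κ → ℝ} (hρ0 : ∀ z c, 0 ≤ ρ z c) (hρ1 : ∀ z c, ρ z c ≤ 1) (a D : Finset κ)
    (hstar : ∀ (z z' : Fin 2) (u u' : Finset κ), u ⊆ D → u' ⊆ u → z' ≤ z →
      Fp wA f z' (a ∪ u') ≤ (1 - ρ z (a ∪ u) + ρ z' (a ∪ u')) * Fp wA f z (a ∪ u))
    (henv : 0 ≤ boxEnv wA wB f g h ρ a D) : 0 ≤ boxSum wA wB f g h a D :=
  boxSum_nonneg_of_fibre hB hA.nonneg hf0 hg0 hgb hh0 hhb hρ0 hρ1 a D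
    (boxFib_nonneg_of_star hA hf0 hfa hfc hfz hg0 hgc hgz hh0 hha hhz hρ0 hρ1 a D hstar) henv

/-- **T₁ WITH A CUBE CO-SHARED BLOCK OF ANY DIMENSION ⟸ STAR CERTIFICATES FOR THE BOXES.**  Hub coin with any bias, co-shared block
the cube `Finset κ` with any log-modular probability weight, private FKG blocks; `f(z,c,a), g(z,c,b), h(z,a,b)` nonnegative and
monotone in every argument.  If every box `[a, a ∪ D]` of dimension `|D| ≥ 2` admits a ratio `ρ ∈ [0,1]` on its slots satisfying STAR
with `boxEnv ρ a D ≥ 0`, then Sahi's `E₃(f,g,h) ≥ 0` (Kahn's `C₃`). [this work] -/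
theorem sahiE_three_nonneg_T1_cube_of_star [Fintype κ] [DistribLattice α] [DistribLattice β] {wC : Finset κ → ℝ} {wZ : Fin 2 → ℝ}
    (hA : IsFKGMeasure wA) (hB : IsFKGMeasure wB) (hW0 : ∀ c, 0 ≤ wC c) (hW1 : ∑ c, wC c = 1)
    (hWmod : ∀ x y, wC x * wC y = wC (x ∩ y) * wC (x ∪ y))
    (hZ0 : 0 ≤ wZ 0) (hZ1 : 0 ≤ wZ 1) (hZ : wZ 0 + wZ 1 = 1)
    (hf0 : ∀ z c a, 0 ≤ f z c a) (hfa : ∀ z c, Monotone (f z c)) (hfc : ∀ z a, Monotone (fun c => f z c a))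
    (hfz : ∀ c a, f 0 c a ≤ f 1 c a)
    (hg0 : ∀ z c b, 0 ≤ g z c b) (hgb : ∀ z c, Monotone (g z c)) (hgc : ∀ z b, Monotone (fun c => g z c b))
    (hgz : ∀ c b, g 0 c b ≤ g 1 c b)
    (hh0 : ∀ z a b, 0 ≤ h z a b) (hha : ∀ z b, Monotone (fun a => h z a b)) (hhb : ∀ z a, Monotone (h z a))
    (hhz : ∀ a b, h 0 a b ≤ h 1 a b)
    (hcert : ∀ a D : Finset κ, Disjoint a D → 2 ≤ D.card → ∃ ρ : Fin 2 → Finset κ → ℝ,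
      (∀ z c, 0 ≤ ρ z c) ∧ (∀ z c, ρ z c ≤ 1) ∧
      (∀ (z z' : Fin 2) (u u' : Finset κ), u ⊆ D → u' ⊆ u → z' ≤ z →
        Fp wA f z' (a ∪ u') ≤ (1 - ρ z (a ∪ u) + ρ z' (a ∪ u')) * Fp wA f z (a ∪ u)) ∧
      0 ≤ boxEnv wA wB f g h ρ a D) :
    0 ≤ sahiE (W wA wB wC wZ) 3 ![F1 f, F2 g, F3 h] := by
  refine sahiE_three_nonneg_T1_cube_of_boxes hA hB hW0 hW1 hWmod hZ0 hZ1 hZ hf0 hfa hfc hfz hg0 hgb hgc hgz hh0 hha hhb hhz ?_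
  intro a D haD hD
  obtain ⟨ρ, hρ0, hρ1, hstar, henv⟩ := hcert a D haD hD
  exact boxSum_nonneg_of_star hA hB hf0 hfa hfc hfz hg0 hgb hgc hgz hh0 hha hhb hhz hρ0 hρ1 a D hstar henv

end Star

end SahiHubCornerChain

end Summit.CriticalPhenomena.PercolationContinuityZ3.Theorems
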